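import Summits.Ventures.HodgeRepro2.A2PontryaginLefschetzTwelve
import Summits.Ventures.HodgeRepro2.A2LamPowWeilPeriod
import Summits.Ventures.HodgeRepro2.A2PrimitivePart

/-!
# Theorem A's class in the twelve-plane model: the record (A2 annex — summary instance)

For `ι = Fin 12`, `θ = Σ c_p E_p` with all `c_p ≠ 0` and `z ∈ ⋀^{20}` (the model of the Gysin class
`f_*[S] ∈ H^{20}(B)`), Theorem A's class `y = z ⋆ θ⁴` ((S3), (A4.3.3)) satisfies, as kernel
sentences of the model:

1. `y ∈ ⋀⁴` and `y = 4!·(∏ c_p)·vol / 8! • Λ⁸ z` (the operator identity, rows 109–110);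
2. the non-vanishing input `(N)`: `p_W(y) ≠ 0 ⇔ ∃ σ ∈ W, ∫_B z ∧ w_σ ≠ 0` (row 97), equivalently for
   the dual Lefschetz class `Λ⁸ z` (row 112);
3. the Weil projection of `y` is that of its primitive part (row 116);
4. the primitive parts of `y` and of the Lieberman class `y'' = (L⁸)⁻¹ z` are proportional,
   `primPart y = 8!·4!·(∏ c_p)·vol • primPart y''` (row 116) — while `y ≠ κ • y''` in general (row 113).
-/

namespace Summit.Ventures.HodgeRepro2.A2TheoremAClassModel

open WeilPlanes WeilIntegral WeilDetect WeilCoproduct A2HardLefschetzOps A2HardLefschetzMain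
  A2HardLefschetzTwelve A2LiebermanModel A2PontryaginModel A2WeilProjection
  A2WeilProjectionPeriod A2PontryaginLefschetz A2PontryaginLefschetzTwelve A2LamPowWeilPeriod
  A2LefschetzSplitting A2PrimitivePart A2TwelvePlanes

/-- `z ∈ ⋀^{20}` in the form `⋀^{2·12−4}` used by the general statements. -/
lemma mem_twenty {z : A ι₁₂} (hz : z ∈ grading ι₁₂ 20) :
    z ∈ grading ι₁₂ (2 * Fintype.card ι₁₂ - 4) := by
  rw [card_ι₁₂]; exact hz

/-- `4 ≤ 12`. -/
lemma four_le_card : 4 ≤ Fintype.card ι₁₂ := by rw [card_ι₁₂]; norm_num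

/-- **(1) Theorem A's class lies in `⋀⁴`.** -/
theorem class_mem_four (c : ι₁₂ → ℂ) (hc : ∀ p, c p ≠ 0) {z : A ι₁₂} (hz : z ∈ grading ι₁₂ 20) :
    pontryagin z (theta c ^ 4) ∈ grading ι₁₂ 4 :=
  pontryagin_theta_pow_mem_grading hc four_le_card (mem_twenty hz)

/-- **(1) Theorem A's class is the dual Lefschetz class**: `y = 4!·(∏ c_p)·vol / 8! • Λ⁸ z`. -/
theorem class_eq_smul_lam_pow (c : ι₁₂ → ℂ) (hc : ∀ p, c p ≠ 0) (z : A ι₁₂) :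
    pontryagin z (theta c ^ 4) =
      ((((4 : ℕ).factorial : ℂ) * ∏ p, c p) * vol ι₁₂ / ((8 : ℕ).factorial : ℂ)) •
        (lam c ^ 8) z :=
  pontryagin_theta_pow_four c hc z

/-- **(2) The non-vanishing input (N)**: for a family `W` of Weil data of size `4`,
`p_W(y) ≠ 0 ⇔ ∃ σ ∈ W, ∫_B z ∧ w_σ ≠ 0`. -/
theorem weilProjModel_class_ne_zero_iff (c : ι₁₂ → ℂ) (hc : ∀ p, c p ≠ 0) (z : A ι₁₂)
    (W : Finset (Finset ι₁₂ × Bool)) (hW : ∀ d ∈ W, d.1.card = 4) :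
    weilProjModel W (pontryagin z (theta c ^ 4)) ≠ 0 ↔
      ∃ d ∈ W, integral (z * weil d.1 !d.2) ≠ 0 :=
  weilProjModel_pontryagin_ne_zero_iff W 4 (by norm_num) hW c hc z

/-- **(2') (N) for the dual Lefschetz class `Λ⁸ z`.** -/
theorem weilProjModel_lam_pow_eight_ne_zero_iff (c : ι₁₂ → ℂ) (hc : ∀ p, c p ≠ 0) (z : A ι₁₂)
    (W : Finset (Finset ι₁₂ × Bool)) (hW : ∀ d ∈ W, d.1.card = 4) :
    weilProjModel W ((lam c ^ 8) z) ≠ 0 ↔ ∃ d ∈ W, integral (z * weil d.1 !d.2) ≠ 0 := by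
  have h := weilProjModel_lam_pow_ne_zero_iff W (k := 4) (by norm_num) four_le_card hW hc z
  rwa [show Fintype.card ι₁₂ - 4 = 8 by rw [card_ι₁₂]] at h

/-- **(3) The Weil projection of Theorem A's class is that of its primitive part.** -/
theorem weilProjModel_class_eq_primPart (c : ι₁₂ → ℂ) (hc : ∀ p, c p ≠ 0) {z : A ι₁₂}
    (hz : z ∈ grading ι₁₂ 20) (W : Finset (Finset ι₁₂ × Bool)) :
    weilProjModel W (pontryagin z (theta c ^ 4)) =
      weilProjModel W (primPart c hc four_le_card (class_mem_four c hc hz)) :=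
  weilProjModel_eq_primPart hc four_le_card (class_mem_four c hc hz) W

/-- The primitive part depends only on the class (not on the membership proof). -/
lemma primPart_congr {ι : Type*} [DecidableEq ι] [Fintype ι] (c : ι → ℂ) (hc : ∀ p, c p ≠ 0)
    {k : ℕ} (hk : k ≤ Fintype.card ι) {x x' : A ι} (h : x = x') (hx : x ∈ grading ι k)
    (hx' : x' ∈ grading ι k) : primPart c hc hk hx = primPart c hc hk hx' := by
  subst h; rfl

/-- **(4) The primitive parts of Theorem A's class and of the Lieberman class `y'' = (L⁸)⁻¹ z` are
proportional**: `primPart y = 8!·4!·(∏ c_p)·vol • primPart y''`. -/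
theorem primPart_class_eq_smul_primPart_yPP (c : ι₁₂ → ℂ) (hc : ∀ p, c p ≠ 0) {z : A ι₁₂}
    (hz : z ∈ grading ι₁₂ 20) :
    primPart c hc four_le_card (class_mem_four c hc hz) =
      ((((8 : ℕ).factorial : ℂ) * ((4 : ℕ).factorial : ℂ) * ∏ p, c p) * vol ι₁₂) •
        primPart c hc four_le_card (yPP_mem c hc hz) := by
  have h := primPart_pontryagin_eq_smul_primPart_lefschetzInv' hc (by norm_num) four_le_card
    (mem_twenty hz)
  rw [show Fintype.card ι₁₂ - 4 = 8 by rw [card_ι₁₂]] at h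
  rw [h]
  exact congrArg (fun w => ((((8 : ℕ).factorial : ℂ) * ((4 : ℕ).factorial : ℂ) * ∏ p, c p) *
    vol ι₁₂) • w) (primPart_congr c hc four_le_card (yPP_eq_lefschetzInv c hc hz).symm _ _)

end Summit.Ventures.HodgeRepro2.A2TheoremAClassModel
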